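import Mathlib.Analysis.SpecialFunctions.Pow.Real
import Mathlib.Algebra.BigOperators.Fin
import Mathlib.Algebra.BigOperators.Intervals
import Mathlib.Algebra.Order.BigOperators.Group.Finset

/-!
# Crux `TwistAmplification.MazurKaneLaw` (stmt-ABC-2757), line `fibre-toolkit-lp-wall-map`: the kit's LP has value `1` at `s₀ = 16/9`
# (a BARRIER theorem for the record pipeline)

Lead c2. The record pipeline certifies `RecordAt s₀ Vc` from a proof of the pure-real linear programme "telescope(J, s₀) → D ≤ Vc + σ"
(`recordInstance_of_lp`, `recordInstanceK_of_lp`). This file proves that NO such proof with `Vc < 1` exists at `s₀ = 16/9`, for any number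
`J ≥ 3` of explicit levels: the hypothesis telescope is satisfied by the explicit exponent datum
`a = (2/9, 2/9, 1/9, 0, …)` (`u x² w³`), `b = (1/3, 1/3, 0, …)` (`u x²`), `c = (2/9, 2/9, 1/9, 0, …)`, `A = C = 5/9`, `B = 2/3`,
`da = db = dc = σ = 0`, with `D = 1` — every member of the five tool families (trivial, determinant, Fourier, geometry of numbers,
square-root lattice, for ALL index finsets) holds at this point, most of them with equality. Hence the landed `recordAt_RF`
(exponent `4s/5 − 19/45`, equal to `1` exactly at `16/9`) is the end of the sub-Kane range of the enlarged fibre toolkit, and a record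
below Kane at any `s ≥ 16/9` needs a new tool (see `Cruxes/MazurKaneLaw/NegativeKitPlateauSixteenNinths.md`). Since the LP value is
monotone in `s₀`, the same holds at every `s₀ ≥ 16/9`.
-/

-- `Summit.<Summit>.<Problem>` is the mandated summit-side namespace; the duplicate `ABC.ABC` is deliberate (single-conjunct summit).
set_option linter.dupNamespace false

namespace Summit.ABC.ABC.Theorems.MazurKaneLaw

/-- Total mass of a profile on `Fin J` (`J ≥ 3`) supported on the indices `0, 1, 2` with values `x, y, z`. -/
theorem kitPlateau_sum_univ_three {J : ℕ} (hJ : 3 ≤ J) (x y z : ℝ) :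
    ∑ k : Fin J, (if (k : ℕ) = 0 then x else if (k : ℕ) = 1 then y else if (k : ℕ) = 2 then z else 0)
      = x + y + z := by
  rw [Fin.sum_univ_eq_sum_range
      (fun n : ℕ => if n = 0 then x else if n = 1 then y else if n = 2 then z else 0) J,
    ← Finset.sum_range_add_sum_Ico _ hJ, Finset.sum_eq_zero (s := Finset.Ico 3 J), add_zero]
  · simp [Finset.sum_range_succ]
  · intro n hn
    have h3 : 3 ≤ n := (Finset.mem_Ico.1 hn).1
    have h0 : n ≠ 0 := by omega
    have h1 : n ≠ 1 := by omega
    have h2 : n ≠ 2 := by omega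
    simp [h0, h1, h2]

/-- First moment `∑ (J - k) f k` of a profile on `Fin J` (`J ≥ 3`) supported on the indices `0, 1, 2` with values
`x, y, z`. -/
theorem kitPlateau_wsum_univ_three {J : ℕ} (hJ : 3 ≤ J) (x y z : ℝ) :
    ∑ k : Fin J, ((J : ℝ) - ((k : ℕ) : ℝ)) *
        (if (k : ℕ) = 0 then x else if (k : ℕ) = 1 then y else if (k : ℕ) = 2 then z else 0)
      = (J : ℝ) * x + ((J : ℝ) - 1) * y + ((J : ℝ) - 2) * z := by
  rw [Fin.sum_univ_eq_sum_range
      (fun n : ℕ => ((J : ℝ) - (n : ℝ)) *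
        (if n = 0 then x else if n = 1 then y else if n = 2 then z else 0)) J,
    ← Finset.sum_range_add_sum_Ico _ hJ, Finset.sum_eq_zero (s := Finset.Ico 3 J), add_zero]
  · simp [Finset.sum_range_succ]
  · intro n hn
    have h3 : 3 ≤ n := (Finset.mem_Ico.1 hn).1
    have h0 : n ≠ 0 := by omega
    have h1 : n ≠ 1 := by omega
    have h2 : n ≠ 2 := by omega
    simp [h0, h1, h2]

/-- A nonnegative profile: one value outside `S` plus the mass on `S` is at most the total mass. -/
theorem kitPlateau_add_sum_le_univ {J : ℕ} {f : Fin J → ℝ} (hf : ∀ k, 0 ≤ f k)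
    {S : Finset (Fin J)} {i : Fin J} (hi : i ∉ S) :
    f i + ∑ k ∈ S, f k ≤ ∑ k, f k := by
  rw [← Finset.sum_insert hi]
  exact Finset.sum_le_univ_sum_of_nonneg hf

/-- A nonnegative profile: two distinct values outside `S` plus the mass on `S` is at most the total mass. -/
theorem kitPlateau_add_add_sum_le_univ {J : ℕ} {f : Fin J → ℝ} (hf : ∀ k, 0 ≤ f k)
    {S : Finset (Fin J)} {i j : Fin J} (hij : i ≠ j) (hi : i ∉ S) (hj : j ∉ S) :
    f i + (f j + ∑ k ∈ S, f k) ≤ ∑ k, f k := by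
  have hi' : i ∉ insert j S := by simp [hij, hi]
  rw [← Finset.sum_insert hj, ← Finset.sum_insert hi']
  exact Finset.sum_le_univ_sum_of_nonneg hf

/-- A nonnegative profile: a single term of the first moment over `S` is at most the first moment over `S`. -/
theorem kitPlateau_single_le_wsum {J : ℕ} {f : Fin J → ℝ} (hf : ∀ k, 0 ≤ f k)
    {S : Finset (Fin J)} {i : Fin J} (hi : i ∈ S) :
    ((i : ℕ) : ℝ) * f i ≤ ∑ k ∈ S, ((k : ℕ) : ℝ) * f k :=
  Finset.single_le_sum (f := fun k : Fin J => ((k : ℕ) : ℝ) * f k)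
    (fun k _ => mul_nonneg (Nat.cast_nonneg _) (hf k)) hi

/-- A nonnegative profile has a nonnegative first moment over every index finset. -/
theorem kitPlateau_wsum_nonneg {J : ℕ} {f : Fin J → ℝ} (hf : ∀ k, 0 ≤ f k) (S : Finset (Fin J)) :
    0 ≤ ∑ k ∈ S, ((k : ℕ) : ℝ) * f k :=
  Finset.sum_nonneg (fun k _ => mul_nonneg (Nat.cast_nonneg _) (hf k))

/-- **The kit's LP has value `1` at `s₀ = 16/9`** (registered sub-goal `kit_lp_value_one_at_sixteen_ninths` of crux stmt-ABC-2757; a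
barrier theorem for the record pipeline): for every `J ≥ 3`, if the LP telescope of `recordInstance_of_lp` at `s₀ = 16/9` implies
`D ≤ Vc + σ`, then `1 ≤ Vc`. Witness: `a = c = (2/9, 2/9, 1/9, 0, …)`, `b = (1/3, 1/3, 0, …)`, deficits and slack `0`, `D = 1`. -/
theorem kit_lp_value_one_at_sixteen_ninths : ∀ (J : ℕ), 3 ≤ J → ∀ Vc : ℝ,
    (∀ (a b c : Fin J → ℝ) (A B C D da db dc σ : ℝ),
      (∀ k, 0 ≤ a k) → (∀ k, 0 ≤ b k) → (∀ k, 0 ≤ c k) →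
      ∑ k, a k ≤ A → ∑ k, b k ≤ B → ∑ k, c k ≤ C →
      ((J : ℝ) + 1) * A - ∑ k : Fin J, ((J : ℝ) - ((k : ℕ) : ℝ)) * a k ≤ 1 - da → 0 ≤ da → da ≤ 1 →
      ((J : ℝ) + 1) * B - ∑ k : Fin J, ((J : ℝ) - ((k : ℕ) : ℝ)) * b k ≤ 1 - db → 0 ≤ db → db ≤ 1 →
      ((J : ℝ) + 1) * C - ∑ k : Fin J, ((J : ℝ) - ((k : ℕ) : ℝ)) * c k ≤ 1 - dc → 0 ≤ dc → dc ≤ σ →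
      0 ≤ σ → σ ≤ 1 / 1000 → A + B + C ≤ (16 / 9 : ℝ) + σ →
      D ≤ A + B + σ → D ≤ A + C + σ → D ≤ B + C + σ →
      (∀ k : Fin J, 1 ≤ (k : ℕ) →
        D ≤ A + B + C - (a k + b k + c k) + σ ∨
        D ≤ A + B + C - 1 + ((((k : ℕ) : ℝ) - 1) * (a k + b k + c k) + (da + db + dc)) / 3 + σ) →
      (∀ (SU SV SW : Finset (Fin J)) (eU eV eW : ℕ), 2 ≤ eU → 2 ≤ eV → 2 ≤ eW →
        (∀ k ∈ SU, eU ∣ (k : ℕ) + 1) → (∀ k ∈ SV, eV ∣ (k : ℕ) + 1) → (∀ k ∈ SW, eW ∣ (k : ℕ) + 1) →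
        ∑ k ∈ SU, a k + ∑ k ∈ SV, b k + ∑ k ∈ SW, c k ≤ 4 * (A + B + C) - 6 * D + σ) →
      (∀ (I J' K : Finset (Fin J)),
        ∑ k ∈ I, a k + ∑ k ∈ J', b k + ∑ k ∈ K, c k ≤ A + B + C - D + σ ∨
        1 - (∑ k ∈ I, ((k : ℕ) : ℝ) * a k + ∑ k ∈ J', ((k : ℕ) : ℝ) * b k + ∑ k ∈ K, ((k : ℕ) : ℝ) * c k) ≤
          A + B + C - D + σ) →
      (∀ (H : Finset (Fin J)) (k : Fin J), 1 ≤ (k : ℕ) →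
        D ≤ A + B + C - (1 - da) + ∑ j ∈ H, ((j : ℕ) : ℝ) * a j + σ ∨
        D ≤ A + B + C - (∑ j ∈ H, a j + b k + c k) + σ) →
      (∀ (H : Finset (Fin J)) (k : Fin J), 1 ≤ (k : ℕ) →
        D ≤ A + B + C - (1 - db) + ∑ j ∈ H, ((j : ℕ) : ℝ) * b j + σ ∨
        D ≤ A + B + C - (∑ j ∈ H, b j + a k + c k) + σ) →
      (∀ (H : Finset (Fin J)) (k : Fin J), 1 ≤ (k : ℕ) →
        D ≤ A + B + C - (1 - dc) + ∑ j ∈ H, ((j : ℕ) : ℝ) * c j + σ ∨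
        D ≤ A + B + C - (∑ j ∈ H, c j + a k + b k) + σ) →
      D ≤ Vc + σ) → 1 ≤ Vc := by
  intro J hJ Vc h
  -- the explicit witness `a = c = (2/9, 2/9, 1/9, 0, …)`, `b = (1/3, 1/3, 0, …)`
  obtain ⟨a, ha⟩ : ∃ a : Fin J → ℝ, ∀ k, a k =
      (if (k : ℕ) = 0 then 2 / 9 else if (k : ℕ) = 1 then 2 / 9 else if (k : ℕ) = 2 then 1 / 9 else 0 : ℝ) :=
    ⟨_, fun _ => rfl⟩
  obtain ⟨b, hb⟩ : ∃ b : Fin J → ℝ, ∀ k, b k =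
      (if (k : ℕ) = 0 then 1 / 3 else if (k : ℕ) = 1 then 1 / 3 else if (k : ℕ) = 2 then 0 else 0 : ℝ) :=
    ⟨_, fun _ => rfl⟩
  obtain ⟨i0, hi0⟩ : ∃ i : Fin J, (i : ℕ) = 0 := ⟨⟨0, by omega⟩, rfl⟩
  obtain ⟨i1, hi1⟩ : ∃ i : Fin J, (i : ℕ) = 1 := ⟨⟨1, by omega⟩, rfl⟩
  obtain ⟨i2, hi2⟩ : ∃ i : Fin J, (i : ℕ) = 2 := ⟨⟨2, by omega⟩, rfl⟩
  have h12 : i1 ≠ i2 := fun he => by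
    have hv := congrArg Fin.val he
    omega
  -- nonnegativity, special values and pointwise bounds
  have ha0 : ∀ k, 0 ≤ a k := fun k => by rw [ha]; split_ifs <;> norm_num
  have hb0 : ∀ k, 0 ≤ b k := fun k => by rw [hb]; split_ifs <;> norm_num
  have hai0 : a i0 = 2 / 9 := by rw [ha, hi0]; simp
  have hbi0 : b i0 = 1 / 3 := by rw [hb, hi0]; simp
  have hai1 : a i1 = 2 / 9 := by rw [ha, hi1]; simp
  have hbi1 : b i1 = 1 / 3 := by rw [hb, hi1]; simp
  have hai2 : a i2 = 1 / 9 := by rw [ha, hi2]; simp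
  have haba : ∀ k, a k + b k + a k ≤ 7 / 9 := fun k => by rw [ha, hb]; split_ifs <;> norm_num
  have hba : ∀ k, b k + a k ≤ 5 / 9 := fun k => by rw [ha, hb]; split_ifs <;> norm_num
  have hab : ∀ k, a k + b k ≤ 5 / 9 := fun k => by rw [ha, hb]; split_ifs <;> norm_num
  have haa : ∀ k, a k + a k ≤ 4 / 9 := fun k => by rw [ha]; split_ifs <;> norm_num
  -- total masses and first moments (exact)
  have hsa : ∑ k, a k = 5 / 9 := by
    simp only [ha]
    rw [kitPlateau_sum_univ_three hJ]
    norm_num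
  have hsb : ∑ k, b k = 2 / 3 := by
    simp only [hb]
    rw [kitPlateau_sum_univ_three hJ]
    norm_num
  have hwa : ∑ k : Fin J, ((J : ℝ) - ((k : ℕ) : ℝ)) * a k = (5 * (J : ℝ) - 4) / 9 := by
    simp only [ha]
    rw [kitPlateau_wsum_univ_three hJ]
    ring
  have hwb : ∑ k : Fin J, ((J : ℝ) - ((k : ℕ) : ℝ)) * b k = (2 * (J : ℝ) - 1) / 3 := by
    simp only [hb]
    rw [kitPlateau_wsum_univ_three hJ]
    ring
  -- lower bounds for first moments over finsets containing a special index
  have la1 : ∀ S : Finset (Fin J), i1 ∈ S → 2 / 9 ≤ ∑ k ∈ S, ((k : ℕ) : ℝ) * a k := fun S hS => by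
    have hl := kitPlateau_single_le_wsum ha0 hS
    rw [hi1, hai1] at hl
    norm_num at hl
    linarith
  have la2 : ∀ S : Finset (Fin J), i2 ∈ S → 2 / 9 ≤ ∑ k ∈ S, ((k : ℕ) : ℝ) * a k := fun S hS => by
    have hl := kitPlateau_single_le_wsum ha0 hS
    rw [hi2, hai2] at hl
    norm_num at hl
    linarith
  have lb1 : ∀ S : Finset (Fin J), i1 ∈ S → 1 / 3 ≤ ∑ k ∈ S, ((k : ℕ) : ℝ) * b k := fun S hS => by
    have hl := kitPlateau_single_le_wsum hb0 hS
    rw [hi1, hbi1] at hl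
    norm_num at hl
    linarith
  -- apply the LP certificate `h` at the witness (`A = C = 5/9`, `B = 2/3`, `D = 1`, deficits and slack `0`)
  suffices key : (1 : ℝ) ≤ Vc + 0 from le_of_le_of_eq key (add_zero Vc)
  refine h a b a (5 / 9) (2 / 3) (5 / 9) 1 0 0 0 0 ha0 hb0 ha0 hsa.le hsb.le hsa.le ?_ le_rfl zero_le_one
    ?_ le_rfl zero_le_one ?_ le_rfl le_rfl le_rfl (by norm_num) (by norm_num) (by norm_num) (by norm_num)
    (by norm_num) ?_ ?_ ?_ ?_ ?_ ?_
  · -- slope of `a` (equality)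
    linarith [hwa]
  · -- slope of `b` (equality)
    linarith [hwb]
  · -- slope of `c = a`
    linarith [hwa]
  · -- determinant family: first disjunct, `a k + b k + c k ≤ 7/9`
    intro k _
    exact Or.inl (by linarith [haba k])
  · -- Fourier family: an admissible index set never contains the index `0`
    intro SU SV SW eU eV eW heU heV heW hU hV hW
    have n0 : ∀ (S : Finset (Fin J)) (e : ℕ), 2 ≤ e → (∀ k ∈ S, e ∣ (k : ℕ) + 1) → i0 ∉ S :=
      fun S e he hS hm => by
        have hd := hS i0 hm
        rw [hi0] at hd
        have hle := Nat.le_of_dvd (by norm_num) hd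
        omega
    have hU' := kitPlateau_add_sum_le_univ ha0 (n0 SU eU heU hU)
    have hV' := kitPlateau_add_sum_le_univ hb0 (n0 SV eV heV hV)
    have hW' := kitPlateau_add_sum_le_univ ha0 (n0 SW eW heW hW)
    linarith
  · -- geometry-of-numbers family
    intro I J' K
    have wI := kitPlateau_wsum_nonneg ha0 I
    have wJ := kitPlateau_wsum_nonneg hb0 J'
    have wK := kitPlateau_wsum_nonneg ha0 K
    by_cases hI1 : i1 ∈ I
    · exact Or.inr (by linarith [la1 I hI1])
    by_cases hI2 : i2 ∈ I
    · exact Or.inr (by linarith [la2 I hI2])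
    by_cases hJ1 : i1 ∈ J'
    · exact Or.inr (by linarith [lb1 J' hJ1])
    by_cases hK1 : i1 ∈ K
    · exact Or.inr (by linarith [la1 K hK1])
    by_cases hK2 : i2 ∈ K
    · exact Or.inr (by linarith [la2 K hK2])
    have sI := kitPlateau_add_add_sum_le_univ ha0 h12 hI1 hI2
    have sJ := kitPlateau_add_sum_le_univ hb0 hJ1
    have sK := kitPlateau_add_add_sum_le_univ ha0 h12 hK1 hK2
    exact Or.inl (by linarith)
  · -- square-root lattice family, host `a`
    intro H k _
    by_cases hH1 : i1 ∈ H
    · exact Or.inl (by linarith [la1 H hH1])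
    by_cases hH2 : i2 ∈ H
    · exact Or.inl (by linarith [la2 H hH2])
    have sH := kitPlateau_add_add_sum_le_univ ha0 h12 hH1 hH2
    exact Or.inr (by linarith [hba k])
  · -- square-root lattice family, host `b`
    intro H k _
    by_cases hH1 : i1 ∈ H
    · exact Or.inl (by linarith [lb1 H hH1])
    have sH := kitPlateau_add_sum_le_univ hb0 hH1
    exact Or.inr (by linarith [haa k])
  · -- square-root lattice family, host `c = a`
    intro H k _
    by_cases hH1 : i1 ∈ H
    · exact Or.inl (by linarith [la1 H hH1])
    by_cases hH2 : i2 ∈ H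
    · exact Or.inl (by linarith [la2 H hH2])
    have sH := kitPlateau_add_add_sum_le_univ ha0 h12 hH1 hH2
    exact Or.inr (by linarith [hab k])

end Summit.ABC.ABC.Theorems.MazurKaneLaw
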